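import Summits.QuantumFields.YangMills.Theses.CoincidenceRotationBootstrap
import Summits.QuantumFields.YangMills.Theses.ScalingWindowSplit
import Summits.QuantumFields.YangMills.Theorems.GronwallGapContinuumFromLatticeGapOneFieldLocal
import Summits.QuantumFields.YangMills.Theorems.ScalingWindowSplitExistenceLegFromLatticeGapped
import Summits.QuantumFields.YangMills.Theorems.PencilRigidityWeakCouplingHypercubicLimitOfScalingWindowSplit
import Summits.QuantumFields.YangMills.Theorems.GapAtCorrelationLength.Negative.GapAtCorrelationLengthFalseOfLightFluxGroup
import HarnessLib

/-!
# Crux `HypercubicLimit` (stmt-QuantumFields-16154) — line `peel-and-disseminate` (payload slug `Sketch`): REGISTERED SKELETON, reshape 6 (c5 seat)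

Crux decl: `Summit.QuantumFields.YangMills.Theses.CoincidenceRotationBootstrap.HypercubicLimit`
(`= MirrorModularBoosts.WeakCouplingHypercubicLimit` verbatim; item stmt-QuantumFields-16154; twin stmt-QuantumFields-16120,
pre-re-type twin stmt-QuantumFields-8646).  Seats c1 (PICKED-16154-c1.md), c3 (PICKED-16154-c3.md, reshape 4), c4 (reshape 5),
c5 (this reshape, PICKED.md).  Published as `Cruxes/HypercubicLimit/Lines/peel_and_disseminate.lean`.

## Why reshape 6 (what changed after reshape 5, 2026-08-17 14:42Z → 18:40Z)

Reshape 5 registered ONE stub, the twin's ∃-form heart H16 (`stub_rpCoreDisjoint`: ∀ simple G ∃ r sch, weak ∧ PolyVolume ∧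
PolyRenorm ∧ UniformFunctionalBoundPlanes ∧ (∃ Δ C, RPSpectral r sch Δ C) ∧ κ₃ floor), supplied by the ScalingWindowSplit triple
W₁ (stmt-18927) → U_R (stmt-18014) → W₂ᴳ (stmt-18170) via the landed `stub_rpCoreDisjointOfSWS` (p163229).  Two facts make H16
the wrong registered debt now:
1. **H16 is false modulo a light-flux group** — its clause `RPSpectral r sch Δ C` is RP-spectral clustering over the spatially
   GLOBAL slab class for EVERY compact simple `G`, `SO(3)` included: exactly the conjunct by which W₁ was judged refuted-misstated
   (landed negative lemma `GapAtCorrelationLength_false_of_LightFluxGroup`: 't Hooft light magnetic flux through a spatial 2-torus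
   of a centre-free group).  The same bookkeeping kills H16: `not_rpCoreDisjoint_of_lightFluxGroup` (§4, sorry-free).
2. **The suppliers moved.**  The r1 redirect strategist (cstrat-8646, 16:53Z; `STRATEGY-CENSUS.md`, `SPLIT-r1.md`, glue certified in
   `SplitGlue_r1.lean`) decomposed THIS crux onto the REPAIRED lattice triple — W₁ᴸ `GapAtCorrelationLengthLocal` (RP-spectral clause
   over the LOCAL slab class = the hypothesis of the landed local seam `ContinuumFromLatticeGap.oneField_of_latticeInequalities_local`),
   U_RS `SelfNormalisedMomentBoundsRS` (`IsCompactSimpleLieGroup G →` inserted; U_R is HELD by the masked-sector negative lemma), W₂ᴳ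
   `SelfNormalisedSkewnessGapped` (= stmt-18170 verbatim) — prepared the `--split` onto it (bounced final-cycle-only; to be re-run by
   tenure / operator) and asked ScalingWindowSplit tenure to `--restate` 18927 / 18014 to these exact texts.  W₁ᴸ does NOT give H16
   (local ⊉ global): after the restate nothing filed supplies H16, while the repaired triple closes the crux directly through the local seam.
Reshape 6 therefore registers the repaired triple itself as the three stubs and takes the certified glue as the composition.

## Texts of the stubs (registry-safe renderings; fidelity checked in §1b)
The stub registry splits a signature at its first `:=`, so the `let`/`letI`/structure-update syntax of the filed texts cannot appear in
a stub statement.  The stubs below are the strategist's `children.json` texts under the MECHANICAL rewriting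
`let x : τ := v; b  ↦  (fun (x : τ) => b) v`, `{ sch with c := f, m := g }  ↦  SpeciesScheme.mk sch.a sch.a_pos sch.tendsto_a sch.β sch.L sch.tendsto_L f g`,
`letI := borel G; haveI := ⟨rfl⟩  ↦  instance binders [MeasurableSpace G] [BorelSpace G]`, `let E := EuclideanSpace ℝ (Fin 4)` expanded:
* `stub_momentBoundsRS` is `Iff.rfl` to the filed U_RS text (β versus ζ reduction);
* `stub_gapLocal` ↔ the filed W₁ᴸ text by `gapLocal_iff_filed` (every Borel structure on `G` is `borel G`);
* `stub_skewnessGapped` IS the route decl `ScalingWindowSplit.SelfNormalisedSkewnessGapped` (stmt-18170) BY NAME.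

## Composition (kernel-checked here; every non-stub arrow is a tree theorem)

  `stub_gapLocal` (W₁ᴸ, OPEN — IR: weak-coupling lattice mass gap for simple G, Chatterjee Problem 5.1 in sequence form; no line anywhere)
  `stub_momentBoundsRS` (U_RS, OPEN — UV: k-uniform n!-moment bounds of self-normalised tr F², observable-level Bałaban; line Sketch_RS on 18014)
  `stub_skewnessGapped` (W₂ᴳ = stmt-18170, OPEN — κ₃ floor at one scale; registered line quartic-uv-transfer on 18170)
     ── `HypercubicLimit_of` = `hypercubicLimit_iff_oneFieldWeak.mpr` ∘ LANDED local seam `oneField_of_latticeInequalities_local` ⇒ the crux BY NAME.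
  Cross-checks with NO sorry in their cone (§3): `HypercubicLimit_ofCurrentSWS` (the CURRENT items 18927/18014/18170 close the crux THROUGH the
  stubs: W₁ → W₁ᴸ, U_R → U_RS are weakenings), `HypercubicLimit_ofCurrentSWS'` (the route's own typed split), `HypercubicLimit_ofH16`
  (reshape 5's composition p149207, hypothesis form), and §4 `not_rpCoreDisjoint_of_lightFluxGroup`.

All three stubs are filed / to-be-filed ITEMS with their own seats and crux directories; a stub-worker here could only answer `stub-blocked`.
-/

set_option autoImplicit false

noncomputable section

open scoped SchwartzMap ENNReal BigOperators Topology
open MeasureTheory Filter Topology Set Function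
open Literature.MathematicalPhysics.AQFT Literature.MathematicalPhysics.QuantumLattice
open Literature.MathematicalPhysics.QuantumFieldTheory
open Summit.QuantumFields.YangMills.Cruxes.HypercubicLimit.CouplingResponse
  (PolyVolume PolyRenorm UniformFunctionalBoundPlanes RPSpectral)
open Summit.QuantumFields.YangMills.Theorems.GapAtCorrelationLength.Negative (LightFluxMode LightFluxGroup)

namespace Summit.QuantumFields.YangMills.Cruxes.HypercubicLimit.PeelAndDisseminate

/-! ## §1 The three registered stubs (the ONLY sorries): the repaired lattice triple -/

/-- **stub W₁ᴸ — `GapAtCorrelationLengthLocal` (OPEN; IR, renormalisation-free; the REPAIRED stmt-QuantumFields-18927).**  For every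
compact simple `G` (and every Borel structure on it): a faithful `r`, a Wilson scheme AT WEAK COUPLING with polynomial volumes, `Δ > 0`,
`C` with the volume-uniform lattice gap `HasLatticeMassGap r sch Δ` and its RP-spectral form over the LOCAL slab class (bounded measurable
`Y` on the time slab `[1,T₀]` inside the spatial box `|x_i| ≤ R`, `2(R+1) ≤ S₀`), one past-supported bump `u`, `p`, `M` with eventually the
floor `a_k^p ≤ T⁰_k(u,θu)` and the one-step window `T⁰_k(u,θu) ≤ M·T⁰_k(τ₋₁u,θτ₋₁u)` (`bare` = `sch` with `c ≡ 1, m ≡ 0`; `T w k` = the BARE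
truncated two-point function at the reflected pair).  Filed text: `Cruxes/GapAtCorrelationLength/RestateKit.lean :: GapAtCorrelationLengthLocal`
(= `children.json[0]` of `SPLIT-r1.md`); equivalence `gapLocal_iff_filed`.  FALSE for `U(1)₄` and finite `G`; the local class dodges the
`SO(3)` light flux. -/
theorem stub_gapLocal :
    ∀ (G : Type) [Group G] [TopologicalSpace G] [IsTopologicalGroup G] [CompactSpace G] [MeasurableSpace G] [BorelSpace G], IsCompactSimpleLieGroup G → ∃ (r : LatticeRep G) (sch : SpeciesScheme (YMSpecies G)) (u : SchwartzMap (EuclideanSpace ℝ (Fin 4)) ℝ) (p : ℕ) (M Δ C : ℝ), (fun (bare : SpeciesScheme (YMSpecies G)) => (fun (T : SchwartzMap (EuclideanSpace ℝ (Fin 4)) ℝ → ℕ → ℝ) => sch.HasWeakCouplingLimit ∧ (∃ N : ℕ, 1 ≤ N ∧ ∀ᶠ k in Filter.atTop, (sch.a k)⁻¹ ≤ (sch.a k * (sch.L k : ℝ)) ^ N) ∧ 0 < Δ ∧ HasLatticeMassGap r sch Δ ∧ (∀ᶠ k in Filter.atTop, ∀ (S₀ T₀ n R : ℕ), sch.L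 k ≤ S₀ → 2 * (T₀ + n + 1) ≤ S₀ → 2 * (R + 1) ≤ S₀ → ∀ (Y : LGConfig 4 G → ℝ) (B : ℝ), Measurable Y → (∀ U, |Y U| ≤ B) → DependsOn Y {e : Literature.MathematicalPhysics.QuantumLattice.ZdEdge 4 | (1 ≤ e.1 0 ∧ e.1 0 + (if e.2 = 0 then 1 else 0) ≤ T₀) ∧ ∀ i : Fin 4, i ≠ 0 → |e.1 i| ≤ R} → |(∫ U, Y (torusLift (2 * S₀ + 1) (GaugeConfig.timeReflect U)) * Y (configShift (-Pi.single 0 (n : ℤ)) (torusLift (2 * S₀ + 1) U)) ∂(wilsonMeasure r.ρ (sch.β k) : Measure (GaugeConfig 4 (2 * S₀ + 1) G))) - (∫ U, Y (torusLift (2 * S₀ + 1) U) ∂(wilsonMeasure r.ρ (sch.β k) : Measure (GaugeConfig 4 (2 * S₀ + 1) G))) ^ 2| ≤ Real.exp (-(Δ * sch.a k * n)) * ((∫ U, Y (torusLift (2 * S₀ + 1) (GaugeConfig.timeReflect U)) * Y (torusLift (2 * S₀ + 1) U) ∂(wilsonMeasure r.ρ (sch.β k) : Measure (GaugeConfig 4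 (2 * S₀ + 1) G))) - (∫ U, Y (torusLift (2 * S₀ + 1) U) ∂(wilsonMeasure r.ρ (sch.β k) : Measure (GaugeConfig 4 (2 * S₀ + 1) G))) ^ 2) + C * B ^ 2 * Real.exp (-(Δ * sch.a k * S₀))) ∧ tsupport u ⊆ {y : EuclideanSpace ℝ (Fin 4) | y 0 < 0} ∧ ∀ᶠ k in Filter.atTop, (sch.a k) ^ p ≤ T u k ∧ T u k ≤ M * T (timeShiftTest 4 (-1) u) k) (fun w k => latticeSchwinger r.ρ bare (fun s => s.F) k (1 + 1) (fun _ => r.curvature) ![w, thetaTest 4 w] - latticeSchwinger r.ρ bare (fun s => s.F) k 1 (fun _ => r.curvature) ![w] * latticeSchwinger r.ρ bare (fun s => s.F) k 1 (fun _ => r.curvature) ![thetaTest 4 w])) (SpeciesScheme.mk sch.a sch.a_pos sch.tendsto_a sch.β sch.L sch.tendsto_L (fun _ _ => 1) (fun _ _ => 0)) := by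
  sorry

/-- **stub U_RS — `SelfNormalisedMomentBoundsRS` (OPEN; UV, no existential; the REPAIRED stmt-QuantumFields-18014).**  For every compact
SIMPLE `G`, faithful `r`, scheme at weak coupling with polynomial volumes, past-supported bump `u`, `p`, `M` with the floor and the window:
the plane-resolved smeared plaquette fields of the SELF-NORMALISED scheme `canon` (`c'_k = 1/√T⁰_k(u,θu)`, `m'_k` = torus mean of the
action density) obey `k`-uniform factorial moment bounds on normalised, pairwise plane-wise disjoint tuples.  Filed text:
`Cruxes/SelfNormalisedMomentBoundsR/MaskedSectorObstruction.lean :: Strategist.SelfNormalisedMomentBoundsRS` (= `children.json[1]`), `Iff.rfl`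
(§1b).  Observable-level Bałaban UV stability (barrier `UVStabilityNonUniqueness`); live line `Sketch_RS` on stmt-18014. -/
theorem stub_momentBoundsRS :
    ∀ (G : Type) [Group G] [TopologicalSpace G] [IsTopologicalGroup G] [CompactSpace G] [MeasurableSpace G] [BorelSpace G], IsCompactSimpleLieGroup G → ∀ (r : LatticeRep G) (sch : SpeciesScheme (YMSpecies G)) (u : SchwartzMap (EuclideanSpace ℝ (Fin 4)) ℝ) (p : ℕ) (M : ℝ), (fun (bare : SpeciesScheme (YMSpecies G)) => (fun (T : SchwartzMap (EuclideanSpace ℝ (Fin 4)) ℝ → ℕ → ℝ) => (fun (canon : SpeciesScheme (YMSpecies G)) => sch.HasWeakCouplingLimit → (∃ N : ℕ, 1 ≤ N ∧ ∀ᶠ k in Filter.atTop, (sch.a k)⁻¹ ≤ (sch.a k * (sch.L k : ℝ)) ^ N) → tsupport u ⊆ {y : EuclideanSpace ℝ (Fin 4) | y 0 < 0} → (∀ᶠ k in Filter.atTop, (sch.a k) ^ p ≤ T u k ∧ T u k ≤ M * T (timeShiftTest 4 (-1) u) k) → ∃ (s : ℕ) (C₀ C₁ : ℝ), ∀ (n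 : ℕ) (F : Fin n → {q : Fin 4 × Fin 4 // q.1 < q.2} → SchwartzMap (EuclideanSpace ℝ (Fin 4)) ℝ), (∀ i, ∑ q, schwartzNorm s (ofRealTest (F i q)) ≤ 1) → (∀ i j, i ≠ j → ∀ q q', Disjoint (tsupport (F i q)) (tsupport (F j q'))) → ∀ k : ℕ, |∫ U, ∏ i, ∑ q : {q : Fin 4 × Fin 4 // q.1 < q.2}, smearedLatticeField (plaquetteObs r.ρ 0 q.1.1 q.1.2) (Literature.Probability.LatticeModels.box 4 (canon.L k)) (canon.a k) (canon.c r.curvature k) (canon.m r.curvature k / 6) (F i q) (torusLift (canon.side k) U) ∂(wilsonMeasure r.ρ (canon.β k) : Measure (GaugeConfig 4 (canon.side k) G))| ≤ C₀ * C₁ ^ n * n.factorial) (SpeciesScheme.mk sch.a sch.a_pos sch.tendsto_a sch.β sch.L sch.tendsto_L (fun _ k => (Real.sqrt (T u k))⁻¹) (fun _ k => ∫ U, r.curvature.F (torusLift (sch.side k) U) ∂(wilsonMeasure r.ρ (sch.β k))))) (fun w k => latticeSchwinger r.ρ bare (fun s => s.F) k (1 + 1) (fun _ => r.curvature) ![w,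 thetaTest 4 w] - latticeSchwinger r.ρ bare (fun s => s.F) k 1 (fun _ => r.curvature) ![w] * latticeSchwinger r.ρ bare (fun s => s.F) k 1 (fun _ => r.curvature) ![thetaTest 4 w])) (SpeciesScheme.mk sch.a sch.a_pos sch.tendsto_a sch.β sch.L sch.tendsto_L (fun _ _ => 1) (fun _ _ => 0)) := by
  sorry

/-- **stub W₂ᴳ — `ScalingWindowSplit.SelfNormalisedSkewnessGapped` BY NAME (OPEN; item stmt-QuantumFields-18170).**  For every compact
`G`, faithful `r`, scheme at weak coupling WITH the uniform lattice gap, polynomial volumes, past-supported bump with floor and window: a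
pairwise-disjoint real triple and `δ > 0` with eventually `|κ₃| ≥ δ` for the SELF-NORMALISED curvature field.  Tree level is ZERO
(`treeLevelSkewness_vanishes`); registered line `quartic-uv-transfer` on stmt-18170 (= `children.json[2]` verbatim). -/
theorem stub_skewnessGapped :
    Summit.QuantumFields.YangMills.Theses.ScalingWindowSplit.SelfNormalisedSkewnessGapped := by
  sorry

/-! ## §1b Fidelity: the registered texts versus the filed texts -/

/-- `stub_momentBoundsRS` is the filed U_RS text up to β/ζ-reduction. -/
example : (∀ (G : Type) [Group G] [TopologicalSpace G] [IsTopologicalGroup G] [CompactSpace G] [MeasurableSpace G] [BorelSpace G], IsCompactSimpleLieGroup G → ∀ (r : LatticeRep G) (sch : SpeciesScheme (YMSpecies G)) (u : SchwartzMap (EuclideanSpace ℝ (Fin 4)) ℝ) (p : ℕ) (M : ℝ), (fun (bare : SpeciesScheme (YMSpecies G)) => (fun (T : SchwartzMap (EuclideanSpace ℝ (Fin 4)) ℝ → ℕ → ℝ) => (fun (canon : SpeciesScheme (YMSpecies G)) => sch.HasWeakCouplingLimit → (∃ N : ℕ, 1 ≤ N ∧ ∀ᶠ k in Filter.atTop,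 (sch.a k)⁻¹ ≤ (sch.a k * (sch.L k : ℝ)) ^ N) → tsupport u ⊆ {y : EuclideanSpace ℝ (Fin 4) | y 0 < 0} → (∀ᶠ k in Filter.atTop, (sch.a k) ^ p ≤ T u k ∧ T u k ≤ M * T (timeShiftTest 4 (-1) u) k) → ∃ (s : ℕ) (C₀ C₁ : ℝ), ∀ (n : ℕ) (F : Fin n → {q : Fin 4 × Fin 4 // q.1 < q.2} → SchwartzMap (EuclideanSpace ℝ (Fin 4)) ℝ), (∀ i, ∑ q, schwartzNorm s (ofRealTest (F i q)) ≤ 1) → (∀ i j, i ≠ j → ∀ q q', Disjoint (tsupport (F i q)) (tsupport (F j q'))) → ∀ k : ℕ, |∫ U, ∏ i, ∑ q : {q : Fin 4 × Fin 4 // q.1 < q.2}, smearedLatticeField (plaquetteObs r.ρ 0 q.1.1 q.1.2) (Literature.Probability.LatticeModels.box 4 (canon.L k)) (canon.a k) (canon.c r.curvature k) (canon.m r.curvature k / 6) (F i q) (torusLift (canon.side k) U) ∂(wilsonMeasure r.ρ (canon.β k) : Measure (GaugeConfig 4 (canon.side k) G))| ≤ C₀ * C₁ ^ n * n.factorial)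 (SpeciesScheme.mk sch.a sch.a_pos sch.tendsto_a sch.β sch.L sch.tendsto_L (fun _ k => (Real.sqrt (T u k))⁻¹) (fun _ k => ∫ U, r.curvature.F (torusLift (sch.side k) U) ∂(wilsonMeasure r.ρ (sch.β k))))) (fun w k => latticeSchwinger r.ρ bare (fun s => s.F) k (1 + 1) (fun _ => r.curvature) ![w, thetaTest 4 w] - latticeSchwinger r.ρ bare (fun s => s.F) k 1 (fun _ => r.curvature) ![w] * latticeSchwinger r.ρ bare (fun s => s.F) k 1 (fun _ => r.curvature) ![thetaTest 4 w])) (SpeciesScheme.mk sch.a sch.a_pos sch.tendsto_a sch.β sch.L sch.tendsto_L (fun _ _ => 1) (fun _ _ => 0))) ↔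
    (∀ (G : Type) [Group G] [TopologicalSpace G] [IsTopologicalGroup G] [CompactSpace G] [MeasurableSpace G] [BorelSpace G], IsCompactSimpleLieGroup G → ∀ (r : LatticeRep G) (sch : SpeciesScheme (YMSpecies G)) (u : SchwartzMap (EuclideanSpace ℝ (Fin 4)) ℝ) (p : ℕ) (M : ℝ), let bare : SpeciesScheme (YMSpecies G) := { sch with c := fun _ _ => 1, m := fun _ _ => 0 }; let T : SchwartzMap (EuclideanSpace ℝ (Fin 4)) ℝ → ℕ → ℝ := fun w k => latticeSchwinger r.ρ bare (fun s => s.F) k (1 + 1) (fun _ => r.curvature) ![w, thetaTest 4 w] - latticeSchwinger r.ρ bare (fun s => s.F) k 1 (fun _ => r.curvature) ![w] * latticeSchwinger r.ρ bare (fun s => s.F) k 1 (fun _ => r.curvature) ![thetaTest 4 w]; let canon : SpeciesScheme (YMSpecies G) := { sch with c := fun _ k => (Real.sqrt (T u k))⁻¹, m := fun _ k => ∫ U, r.curvature.F (torusLift (sch.side k) U) ∂(wilsonMeasure r.ρ (sch.β k)) }; sch.HasWeakCouplingLimit → (∃ N : ℕ, 1 ≤ N ∧ ∀ᶠ k in Filter.atTop,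 (sch.a k)⁻¹ ≤ (sch.a k * (sch.L k : ℝ)) ^ N) → tsupport u ⊆ {y : EuclideanSpace ℝ (Fin 4) | y 0 < 0} → (∀ᶠ k in Filter.atTop, (sch.a k) ^ p ≤ T u k ∧ T u k ≤ M * T (timeShiftTest 4 (-1) u) k) → ∃ (s : ℕ) (C₀ C₁ : ℝ), ∀ (n : ℕ) (F : Fin n → {q : Fin 4 × Fin 4 // q.1 < q.2} → SchwartzMap (EuclideanSpace ℝ (Fin 4)) ℝ), (∀ i, ∑ q, schwartzNorm s (ofRealTest (F i q)) ≤ 1) → (∀ i j, i ≠ j → ∀ q q', Disjoint (tsupport (F i q)) (tsupport (F j q'))) → ∀ k : ℕ, |∫ U, ∏ i, ∑ q : {q : Fin 4 × Fin 4 // q.1 < q.2}, smearedLatticeField (plaquetteObs r.ρ 0 q.1.1 q.1.2) (Literature.Probability.LatticeModels.box 4 (canon.L k)) (canon.a k) (canon.c r.curvature k) (canon.m r.curvature k / 6) (F i q) (torusLift (canon.side k) U) ∂(wilsonMeasure r.ρ (canon.β k) : Measure (GaugeConfig 4 (canon.side k) G))| ≤ C₀ * C₁ ^ n * n.factorial)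 := Iff.rfl

/-- The route decl of stmt-18170 is the filed W₂ᴳ text (up to the expansion of `let E`). -/
example : Summit.QuantumFields.YangMills.Theses.ScalingWindowSplit.SelfNormalisedSkewnessGapped ↔
    (∀ (G : Type) [Group G] [TopologicalSpace G] [IsTopologicalGroup G] [CompactSpace G] [MeasurableSpace G] [BorelSpace G] (r : LatticeRep G) (sch : SpeciesScheme (YMSpecies G)) (u : SchwartzMap (EuclideanSpace ℝ (Fin 4)) ℝ) (p : ℕ) (M Δ : ℝ), let bare : SpeciesScheme (YMSpecies G) := { sch with c := fun _ _ => 1, m := fun _ _ => 0 }; let T : SchwartzMap (EuclideanSpace ℝ (Fin 4)) ℝ → ℕ → ℝ := fun w k => latticeSchwinger r.ρ bare (fun s => s.F) k (1 + 1) (fun _ => r.curvature) ![w, thetaTest 4 w] - latticeSchwinger r.ρ bare (fun s => s.F) k 1 (fun _ => r.curvature) ![w] * latticeSchwinger r.ρ bare (fun s => s.F) k 1 (fun _ => r.curvature) ![thetaTest 4 w]; let canon : SpeciesScheme (YMSpecies G) := { sch with c := fun _ k => (Real.sqrt (T u k))⁻¹, m := fun _ k => ∫ U, r.curvature.F (torusLift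 (sch.side k) U) ∂(wilsonMeasure r.ρ (sch.β k)) }; sch.HasWeakCouplingLimit → 0 < Δ → HasLatticeMassGap r sch Δ → (∃ N : ℕ, 1 ≤ N ∧ ∀ᶠ k in Filter.atTop, (sch.a k)⁻¹ ≤ (sch.a k * (sch.L k : ℝ)) ^ N) → tsupport u ⊆ {y : EuclideanSpace ℝ (Fin 4) | y 0 < 0} → (∀ᶠ k in Filter.atTop, (sch.a k) ^ p ≤ T u k ∧ T u k ≤ M * T (timeShiftTest 4 (-1) u) k) → ∃ (f g h : SchwartzMap (EuclideanSpace ℝ (Fin 4)) ℝ) (δ : ℝ), Disjoint (tsupport f) (tsupport g) ∧ Disjoint (tsupport f) (tsupport h) ∧ Disjoint (tsupport g) (tsupport h) ∧ 0 < δ ∧ ∀ᶠ k in Filter.atTop, δ ≤ |latticeSchwinger r.ρ canon (fun s => s.F) k 3 (fun _ => r.curvature) ![f, g, h] - latticeSchwinger r.ρ canon (fun s => s.F) k 1 (fun _ => r.curvature) ![f] * latticeSchwinger r.ρ canon (fun s => s.F) k 2 (fun _ => r.curvature) ![g, h] - latticeSchwinger r.ρ canon (fun s => s.F) k 1 (fun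 _ => r.curvature) ![g] * latticeSchwinger r.ρ canon (fun s => s.F) k 2 (fun _ => r.curvature) ![f, h] - latticeSchwinger r.ρ canon (fun s => s.F) k 1 (fun _ => r.curvature) ![h] * latticeSchwinger r.ρ canon (fun s => s.F) k 2 (fun _ => r.curvature) ![f, g] + 2 * (latticeSchwinger r.ρ canon (fun s => s.F) k 1 (fun _ => r.curvature) ![f] * latticeSchwinger r.ρ canon (fun s => s.F) k 1 (fun _ => r.curvature) ![g] * latticeSchwinger r.ρ canon (fun s => s.F) k 1 (fun _ => r.curvature) ![h])|) := Iff.rfl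

/-- **`stub_gapLocal` ↔ the filed W₁ᴸ text**: the registered rendering quantifies over every Borel structure on `G` (instance
binders) where the filed text installs `borel G`; every `BorelSpace` structure IS `borel G`, so the two agree. [folklore] -/
theorem gapLocal_iff_filed :
    (∀ (G : Type) [Group G] [TopologicalSpace G] [IsTopologicalGroup G] [CompactSpace G] [MeasurableSpace G] [BorelSpace G], IsCompactSimpleLieGroup G → ∃ (r : LatticeRep G) (sch : SpeciesScheme (YMSpecies G)) (u : SchwartzMap (EuclideanSpace ℝ (Fin 4)) ℝ) (p : ℕ) (M Δ C : ℝ), (fun (bare : SpeciesScheme (YMSpecies G)) => (fun (T : SchwartzMap (EuclideanSpace ℝ (Fin 4)) ℝ → ℕ → ℝ) => sch.HasWeakCouplingLimit ∧ (∃ N : ℕ, 1 ≤ N ∧ ∀ᶠ k in Filter.atTop, (sch.a k)⁻¹ ≤ (sch.a k * (sch.L k : ℝ)) ^ N) ∧ 0 < Δ ∧ HasLatticeMassGap r sch Δ ∧ (∀ᶠ k in Filter.atTop, ∀ (S₀ T₀ n R : ℕ), sch.L k ≤ S₀ → 2 * (T₀ + n + 1) ≤ S₀ → 2 * (R + 1)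 ≤ S₀ → ∀ (Y : LGConfig 4 G → ℝ) (B : ℝ), Measurable Y → (∀ U, |Y U| ≤ B) → DependsOn Y {e : Literature.MathematicalPhysics.QuantumLattice.ZdEdge 4 | (1 ≤ e.1 0 ∧ e.1 0 + (if e.2 = 0 then 1 else 0) ≤ T₀) ∧ ∀ i : Fin 4, i ≠ 0 → |e.1 i| ≤ R} → |(∫ U, Y (torusLift (2 * S₀ + 1) (GaugeConfig.timeReflect U)) * Y (configShift (-Pi.single 0 (n : ℤ)) (torusLift (2 * S₀ + 1) U)) ∂(wilsonMeasure r.ρ (sch.β k) : Measure (GaugeConfig 4 (2 * S₀ + 1) G))) - (∫ U, Y (torusLift (2 * S₀ + 1) U) ∂(wilsonMeasure r.ρ (sch.β k) : Measure (GaugeConfig 4 (2 * S₀ + 1) G))) ^ 2| ≤ Real.exp (-(Δ * sch.a k * n)) * ((∫ U, Y (torusLift (2 * S₀ + 1) (GaugeConfig.timeReflect U)) * Y (torusLift (2 * S₀ + 1) U) ∂(wilsonMeasure r.ρ (sch.β k) : Measure (GaugeConfig 4 (2 * S₀ + 1) G))) - (∫ U, Y (torusLift (2 * S₀ + 1) U)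 ∂(wilsonMeasure r.ρ (sch.β k) : Measure (GaugeConfig 4 (2 * S₀ + 1) G))) ^ 2) + C * B ^ 2 * Real.exp (-(Δ * sch.a k * S₀))) ∧ tsupport u ⊆ {y : EuclideanSpace ℝ (Fin 4) | y 0 < 0} ∧ ∀ᶠ k in Filter.atTop, (sch.a k) ^ p ≤ T u k ∧ T u k ≤ M * T (timeShiftTest 4 (-1) u) k) (fun w k => latticeSchwinger r.ρ bare (fun s => s.F) k (1 + 1) (fun _ => r.curvature) ![w, thetaTest 4 w] - latticeSchwinger r.ρ bare (fun s => s.F) k 1 (fun _ => r.curvature) ![w] * latticeSchwinger r.ρ bare (fun s => s.F) k 1 (fun _ => r.curvature) ![thetaTest 4 w])) (SpeciesScheme.mk sch.a sch.a_pos sch.tendsto_a sch.β sch.L sch.tendsto_L (fun _ _ => 1) (fun _ _ => 0))) ↔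
    (∀ (G : Type) [Group G] [TopologicalSpace G] [IsTopologicalGroup G] [CompactSpace G], IsCompactSimpleLieGroup G → letI : MeasurableSpace G := borel G; haveI : BorelSpace G := ⟨rfl⟩; ∃ (r : LatticeRep G) (sch : SpeciesScheme (YMSpecies G)) (u : SchwartzMap (EuclideanSpace ℝ (Fin 4)) ℝ) (p : ℕ) (M Δ C : ℝ), let bare : SpeciesScheme (YMSpecies G) := { sch with c := fun _ _ => 1, m := fun _ _ => 0 }; let T : SchwartzMap (EuclideanSpace ℝ (Fin 4)) ℝ → ℕ → ℝ := fun w k => latticeSchwinger r.ρ bare (fun s => s.F) k (1 + 1) (fun _ => r.curvature) ![w, thetaTest 4 w] - latticeSchwinger r.ρ bare (fun s => s.F) k 1 (fun _ => r.curvature) ![w] * latticeSchwinger r.ρ bare (fun s => s.F) k 1 (fun _ => r.curvature) ![thetaTest 4 w]; sch.HasWeakCouplingLimit ∧ (∃ N : ℕ, 1 ≤ N ∧ ∀ᶠ k in Filter.atTop, (sch.a k)⁻¹ ≤ (sch.a k * (sch.L k : ℝ)) ^ N) ∧ 0 < Δ ∧ HasLatticeMassGap r sch Δ ∧ (∀ᶠ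 k in Filter.atTop, ∀ (S₀ T₀ n R : ℕ), sch.L k ≤ S₀ → 2 * (T₀ + n + 1) ≤ S₀ → 2 * (R + 1) ≤ S₀ → ∀ (Y : LGConfig 4 G → ℝ) (B : ℝ), Measurable Y → (∀ U, |Y U| ≤ B) → DependsOn Y {e : Literature.MathematicalPhysics.QuantumLattice.ZdEdge 4 | (1 ≤ e.1 0 ∧ e.1 0 + (if e.2 = 0 then 1 else 0) ≤ T₀) ∧ ∀ i : Fin 4, i ≠ 0 → |e.1 i| ≤ R} → |(∫ U, Y (torusLift (2 * S₀ + 1) (GaugeConfig.timeReflect U)) * Y (configShift (-Pi.single 0 (n : ℤ)) (torusLift (2 * S₀ + 1) U)) ∂(wilsonMeasure r.ρ (sch.β k) : Measure (GaugeConfig 4 (2 * S₀ + 1) G))) - (∫ U, Y (torusLift (2 * S₀ + 1) U) ∂(wilsonMeasure r.ρ (sch.β k) : Measure (GaugeConfig 4 (2 * S₀ + 1) G))) ^ 2| ≤ Real.exp (-(Δ * sch.a k * n)) * ((∫ U, Y (torusLift (2 * S₀ + 1) (GaugeConfig.timeReflect U)) * Y (torusLift (2 * S₀ + 1) U) ∂(wilsonMeasure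 r.ρ (sch.β k) : Measure (GaugeConfig 4 (2 * S₀ + 1) G))) - (∫ U, Y (torusLift (2 * S₀ + 1) U) ∂(wilsonMeasure r.ρ (sch.β k) : Measure (GaugeConfig 4 (2 * S₀ + 1) G))) ^ 2) + C * B ^ 2 * Real.exp (-(Δ * sch.a k * S₀))) ∧ tsupport u ⊆ {y : EuclideanSpace ℝ (Fin 4) | y 0 < 0} ∧ ∀ᶠ k in Filter.atTop, (sch.a k) ^ p ≤ T u k ∧ T u k ≤ M * T (timeShiftTest 4 (-1) u) k) := by
  constructor
  · intro h G _ _ _ _ hG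
    letI : MeasurableSpace G := borel G
    haveI : BorelSpace G := ⟨rfl⟩
    exact h G hG
  · intro h G _ _ _ _ _ hB hG
    obtain ⟨hB'⟩ := hB
    subst hB'
    exact h G hG

/-! ## §2 The composition: the crux BY NAME from the three stubs (the r1 strategist's certified glue; all arrows LANDED) -/

/-- **The whole line as one implication (reshape 6):** W₁ᴸ → U_RS → W₂ᴳ ⇒ `CoincidenceRotationBootstrap.HypercubicLimit` BY NAME —
ONE FIELD SUFFICES (`hypercubicLimit_iff_oneFieldWeak`, p123041); per compact simple `G` take W₁ᴸ's witness `(r, sch, u, p, M, Δ, C)` and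
apply the landed LOCAL seam `ContinuumFromLatticeGap.oneField_of_latticeInequalities_local`, feeding U_RS the consumer's simplicity
hypothesis.  Body = `H21Probe.RepairedSplit.HypercubicLimit_of_subs` (`Cruxes/HypercubicLimit/SplitGlue_r1.lean`).
[cite: GlimmJaffe1987, §6.1 and §19.1] -/
theorem HypercubicLimit_of
    (hW : ∀ (G : Type) [Group G] [TopologicalSpace G] [IsTopologicalGroup G] [CompactSpace G] [MeasurableSpace G] [BorelSpace G], IsCompactSimpleLieGroup G → ∃ (r : LatticeRep G) (sch : SpeciesScheme (YMSpecies G)) (u : SchwartzMap (EuclideanSpace ℝ (Fin 4)) ℝ) (p : ℕ) (M Δ C : ℝ), (fun (bare : SpeciesScheme (YMSpecies G)) => (fun (T : SchwartzMap (EuclideanSpace ℝ (Fin 4)) ℝ → ℕ → ℝ) => sch.HasWeakCouplingLimit ∧ (∃ N : ℕ, 1 ≤ N ∧ ∀ᶠ k in Filter.atTop, (sch.a k)⁻¹ ≤ (sch.a k * (sch.L k : ℝ)) ^ N) ∧ 0 < Δ ∧ HasLatticeMassGap r sch Δ ∧ (∀ᶠ k in Filter.atTop, ∀ (S₀ T₀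 n R : ℕ), sch.L k ≤ S₀ → 2 * (T₀ + n + 1) ≤ S₀ → 2 * (R + 1) ≤ S₀ → ∀ (Y : LGConfig 4 G → ℝ) (B : ℝ), Measurable Y → (∀ U, |Y U| ≤ B) → DependsOn Y {e : Literature.MathematicalPhysics.QuantumLattice.ZdEdge 4 | (1 ≤ e.1 0 ∧ e.1 0 + (if e.2 = 0 then 1 else 0) ≤ T₀) ∧ ∀ i : Fin 4, i ≠ 0 → |e.1 i| ≤ R} → |(∫ U, Y (torusLift (2 * S₀ + 1) (GaugeConfig.timeReflect U)) * Y (configShift (-Pi.single 0 (n : ℤ)) (torusLift (2 * S₀ + 1) U)) ∂(wilsonMeasure r.ρ (sch.β k) : Measure (GaugeConfig 4 (2 * S₀ + 1) G))) - (∫ U, Y (torusLift (2 * S₀ + 1) U) ∂(wilsonMeasure r.ρ (sch.β k) : Measure (GaugeConfig 4 (2 * S₀ + 1) G))) ^ 2| ≤ Real.exp (-(Δ * sch.a k * n)) * ((∫ U, Y (torusLift (2 * S₀ + 1) (GaugeConfig.timeReflect U)) * Y (torusLift (2 * S₀ + 1) U) ∂(wilsonMeasure r.ρ (sch.β k) :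 Measure (GaugeConfig 4 (2 * S₀ + 1) G))) - (∫ U, Y (torusLift (2 * S₀ + 1) U) ∂(wilsonMeasure r.ρ (sch.β k) : Measure (GaugeConfig 4 (2 * S₀ + 1) G))) ^ 2) + C * B ^ 2 * Real.exp (-(Δ * sch.a k * S₀))) ∧ tsupport u ⊆ {y : EuclideanSpace ℝ (Fin 4) | y 0 < 0} ∧ ∀ᶠ k in Filter.atTop, (sch.a k) ^ p ≤ T u k ∧ T u k ≤ M * T (timeShiftTest 4 (-1) u) k) (fun w k => latticeSchwinger r.ρ bare (fun s => s.F) k (1 + 1) (fun _ => r.curvature) ![w, thetaTest 4 w] - latticeSchwinger r.ρ bare (fun s => s.F) k 1 (fun _ => r.curvature) ![w] * latticeSchwinger r.ρ bare (fun s => s.F) k 1 (fun _ => r.curvature) ![thetaTest 4 w])) (SpeciesScheme.mk sch.a sch.a_pos sch.tendsto_a sch.β sch.L sch.tendsto_L (fun _ _ => 1) (fun _ _ => 0)))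
    (hU : ∀ (G : Type) [Group G] [TopologicalSpace G] [IsTopologicalGroup G] [CompactSpace G] [MeasurableSpace G] [BorelSpace G], IsCompactSimpleLieGroup G → ∀ (r : LatticeRep G) (sch : SpeciesScheme (YMSpecies G)) (u : SchwartzMap (EuclideanSpace ℝ (Fin 4)) ℝ) (p : ℕ) (M : ℝ), (fun (bare : SpeciesScheme (YMSpecies G)) => (fun (T : SchwartzMap (EuclideanSpace ℝ (Fin 4)) ℝ → ℕ → ℝ) => (fun (canon : SpeciesScheme (YMSpecies G)) => sch.HasWeakCouplingLimit → (∃ N : ℕ, 1 ≤ N ∧ ∀ᶠ k in Filter.atTop, (sch.a k)⁻¹ ≤ (sch.a k * (sch.L k : ℝ)) ^ N) → tsupport u ⊆ {y : EuclideanSpace ℝ (Fin 4) | y 0 < 0} → (∀ᶠ k in Filter.atTop, (sch.a k) ^ p ≤ T u k ∧ T u k ≤ M * T (timeShiftTest 4 (-1) u) k) → ∃ (s : ℕ) (C₀ C₁ : ℝ), ∀ (n : ℕ) (F : Fin n → {q : Fin 4 × Fin 4 // q.1 < q.2} → SchwartzMap (EuclideanSpace ℝ (Fin 4)) ℝ),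 (∀ i, ∑ q, schwartzNorm s (ofRealTest (F i q)) ≤ 1) → (∀ i j, i ≠ j → ∀ q q', Disjoint (tsupport (F i q)) (tsupport (F j q'))) → ∀ k : ℕ, |∫ U, ∏ i, ∑ q : {q : Fin 4 × Fin 4 // q.1 < q.2}, smearedLatticeField (plaquetteObs r.ρ 0 q.1.1 q.1.2) (Literature.Probability.LatticeModels.box 4 (canon.L k)) (canon.a k) (canon.c r.curvature k) (canon.m r.curvature k / 6) (F i q) (torusLift (canon.side k) U) ∂(wilsonMeasure r.ρ (canon.β k) : Measure (GaugeConfig 4 (canon.side k) G))| ≤ C₀ * C₁ ^ n * n.factorial) (SpeciesScheme.mk sch.a sch.a_pos sch.tendsto_a sch.β sch.L sch.tendsto_L (fun _ k => (Real.sqrt (T u k))⁻¹) (fun _ k => ∫ U, r.curvature.F (torusLift (sch.side k) U) ∂(wilsonMeasure r.ρ (sch.β k))))) (fun w k => latticeSchwinger r.ρ bare (fun s => s.F) k (1 + 1) (fun _ => r.curvature) ![w, thetaTest 4 w] - latticeSchwinger r.ρ bare (fun s => s.F) k 1 (fun _ => r.curvature) ![w] * latticeSchwinger r.ρ bare (fun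 s => s.F) k 1 (fun _ => r.curvature) ![thetaTest 4 w])) (SpeciesScheme.mk sch.a sch.a_pos sch.tendsto_a sch.β sch.L sch.tendsto_L (fun _ _ => 1) (fun _ _ => 0)))
    (hS : Summit.QuantumFields.YangMills.Theses.ScalingWindowSplit.SelfNormalisedSkewnessGapped) :
    Summit.QuantumFields.YangMills.Theses.CoincidenceRotationBootstrap.HypercubicLimit := by
  refine Summit.QuantumFields.YangMills.Theorems.HypercubicLimit.OneFieldWeak.hypercubicLimit_iff_oneFieldWeak.mpr
    fun G _ _ _ _ hG => ?_
  letI : MeasurableSpace G := borel G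
  haveI : BorelSpace G := ⟨rfl⟩
  obtain ⟨r, sch, u, p, M, Δ, C, hw, hpv, hΔ, hgap, hrp, hu, hfw⟩ := hW G hG
  obtain ⟨sch', S₁, hw', h₁⟩ :=
    Summit.QuantumFields.YangMills.Theorems.ContinuumFromLatticeGap.oneField_of_latticeInequalities_local
      r sch u p M Δ C hw hpv hΔ hgap hrp hu hfw
      (hU G hG r sch u p M hw hpv hu hfw) (hS G r sch u p M Δ hw hΔ hgap hpv hu hfw)
  exact ⟨r, sch', S₁, hw', h₁⟩

/-- **Registered target of the skeleton** (checker convention `<Crux>_proof`): the crux `CoincidenceRotationBootstrap.HypercubicLimit`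
(item stmt-QuantumFields-16154) from the three registered stubs.  No `sorry` of its own. -/
theorem HypercubicLimit_proof :
    Summit.QuantumFields.YangMills.Theses.CoincidenceRotationBootstrap.HypercubicLimit :=
  HypercubicLimit_of stub_gapLocal stub_momentBoundsRS stub_skewnessGapped

/-! ## §3 Cross-checks with NO sorry in their cone -/

/-- **W₁ → W₁ᴸ** (the CURRENT stmt-18927 implies the first stub: the local slab class is a subclass of the slab class).
-- adapted from Cruxes/GapAtCorrelationLength/RestateKit.lean [folklore] -/
theorem gapLocal_of_currentW₁
    (h : Summit.QuantumFields.YangMills.Theses.ScalingWindowSplit.GapAtCorrelationLength) :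
    ∀ (G : Type) [Group G] [TopologicalSpace G] [IsTopologicalGroup G] [CompactSpace G] [MeasurableSpace G] [BorelSpace G], IsCompactSimpleLieGroup G → ∃ (r : LatticeRep G) (sch : SpeciesScheme (YMSpecies G)) (u : SchwartzMap (EuclideanSpace ℝ (Fin 4)) ℝ) (p : ℕ) (M Δ C : ℝ), (fun (bare : SpeciesScheme (YMSpecies G)) => (fun (T : SchwartzMap (EuclideanSpace ℝ (Fin 4)) ℝ → ℕ → ℝ) => sch.HasWeakCouplingLimit ∧ (∃ N : ℕ, 1 ≤ N ∧ ∀ᶠ k in Filter.atTop, (sch.a k)⁻¹ ≤ (sch.a k * (sch.L k : ℝ)) ^ N) ∧ 0 < Δ ∧ HasLatticeMassGap r sch Δ ∧ (∀ᶠ k in Filter.atTop, ∀ (S₀ T₀ n R : ℕ), sch.L k ≤ S₀ → 2 * (T₀ + n + 1) ≤ S₀ → 2 * (R + 1) ≤ S₀ → ∀ (Y : LGConfig 4 G → ℝ) (B : ℝ), Measurable Y → (∀ U, |Y U| ≤ B) → DependsOn Y {e : Literature.MathematicalPhysics.QuantumLattice.ZdEdge 4 | (1 ≤ e.1 0 ∧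 e.1 0 + (if e.2 = 0 then 1 else 0) ≤ T₀) ∧ ∀ i : Fin 4, i ≠ 0 → |e.1 i| ≤ R} → |(∫ U, Y (torusLift (2 * S₀ + 1) (GaugeConfig.timeReflect U)) * Y (configShift (-Pi.single 0 (n : ℤ)) (torusLift (2 * S₀ + 1) U)) ∂(wilsonMeasure r.ρ (sch.β k) : Measure (GaugeConfig 4 (2 * S₀ + 1) G))) - (∫ U, Y (torusLift (2 * S₀ + 1) U) ∂(wilsonMeasure r.ρ (sch.β k) : Measure (GaugeConfig 4 (2 * S₀ + 1) G))) ^ 2| ≤ Real.exp (-(Δ * sch.a k * n)) * ((∫ U, Y (torusLift (2 * S₀ + 1) (GaugeConfig.timeReflect U)) * Y (torusLift (2 * S₀ + 1) U) ∂(wilsonMeasure r.ρ (sch.β k) : Measure (GaugeConfig 4 (2 * S₀ + 1) G))) - (∫ U, Y (torusLift (2 * S₀ + 1) U) ∂(wilsonMeasure r.ρ (sch.β k) : Measure (GaugeConfig 4 (2 * S₀ + 1) G))) ^ 2) + C * B ^ 2 * Real.exp (-(Δ * sch.a k * S₀))) ∧ tsupport u ⊆ {y : EuclideanSpace ℝ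 (Fin 4) | y 0 < 0} ∧ ∀ᶠ k in Filter.atTop, (sch.a k) ^ p ≤ T u k ∧ T u k ≤ M * T (timeShiftTest 4 (-1) u) k) (fun w k => latticeSchwinger r.ρ bare (fun s => s.F) k (1 + 1) (fun _ => r.curvature) ![w, thetaTest 4 w] - latticeSchwinger r.ρ bare (fun s => s.F) k 1 (fun _ => r.curvature) ![w] * latticeSchwinger r.ρ bare (fun s => s.F) k 1 (fun _ => r.curvature) ![thetaTest 4 w])) (SpeciesScheme.mk sch.a sch.a_pos sch.tendsto_a sch.β sch.L sch.tendsto_L (fun _ _ => 1) (fun _ _ => 0)) := by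
  intro G _ _ _ _ _ hB hG
  obtain ⟨hB'⟩ := hB
  subst hB'
  obtain ⟨r, sch, u, p, M, Δ, C, hw, hpv, hΔ, hgap, hrp, hu, hfw⟩ := h G hG
  refine ⟨r, sch, u, p, M, Δ, C, hw, hpv, hΔ, hgap, ?_, hu, hfw⟩
  filter_upwards [hrp] with k hk S₀ T₀ n R hL h2 _hR Y B hYm hYb hYdep
  exact hk S₀ T₀ n hL h2 Y B hYm hYb (hYdep.mono fun e he => he.1)

/-- **U_R → U_RS** (the CURRENT stmt-18014 implies the second stub: drop the simplicity hypothesis).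
-- adapted from Cruxes/SelfNormalisedMomentBoundsR/MaskedSectorObstruction.lean [folklore] -/
theorem momentBoundsRS_of_currentU
    (h : Summit.QuantumFields.YangMills.Theses.ScalingWindowSplit.SelfNormalisedMomentBoundsR) :
    ∀ (G : Type) [Group G] [TopologicalSpace G] [IsTopologicalGroup G] [CompactSpace G] [MeasurableSpace G] [BorelSpace G], IsCompactSimpleLieGroup G → ∀ (r : LatticeRep G) (sch : SpeciesScheme (YMSpecies G)) (u : SchwartzMap (EuclideanSpace ℝ (Fin 4)) ℝ) (p : ℕ) (M : ℝ), (fun (bare : SpeciesScheme (YMSpecies G)) => (fun (T : SchwartzMap (EuclideanSpace ℝ (Fin 4)) ℝ → ℕ → ℝ) => (fun (canon : SpeciesScheme (YMSpecies G)) => sch.HasWeakCouplingLimit → (∃ N : ℕ, 1 ≤ N ∧ ∀ᶠ k in Filter.atTop, (sch.a k)⁻¹ ≤ (sch.a k * (sch.L k : ℝ)) ^ N) → tsupport u ⊆ {y : EuclideanSpace ℝ (Fin 4) | y 0 < 0} → (∀ᶠ k in Filter.atTop, (sch.a k) ^ p ≤ T u k ∧ T u k ≤ M * T (timeShiftTest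 4 (-1) u) k) → ∃ (s : ℕ) (C₀ C₁ : ℝ), ∀ (n : ℕ) (F : Fin n → {q : Fin 4 × Fin 4 // q.1 < q.2} → SchwartzMap (EuclideanSpace ℝ (Fin 4)) ℝ), (∀ i, ∑ q, schwartzNorm s (ofRealTest (F i q)) ≤ 1) → (∀ i j, i ≠ j → ∀ q q', Disjoint (tsupport (F i q)) (tsupport (F j q'))) → ∀ k : ℕ, |∫ U, ∏ i, ∑ q : {q : Fin 4 × Fin 4 // q.1 < q.2}, smearedLatticeField (plaquetteObs r.ρ 0 q.1.1 q.1.2) (Literature.Probability.LatticeModels.box 4 (canon.L k)) (canon.a k) (canon.c r.curvature k) (canon.m r.curvature k / 6) (F i q) (torusLift (canon.side k) U) ∂(wilsonMeasure r.ρ (canon.β k) : Measure (GaugeConfig 4 (canon.side k) G))| ≤ C₀ * C₁ ^ n * n.factorial) (SpeciesScheme.mk sch.a sch.a_pos sch.tendsto_a sch.β sch.L sch.tendsto_L (fun _ k => (Real.sqrt (T u k))⁻¹) (fun _ k => ∫ U, r.curvature.F (torusLift (sch.side k) U) ∂(wilsonMeasure r.ρ (sch.β k))))) (fun w k => latticeSchwinger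 r.ρ bare (fun s => s.F) k (1 + 1) (fun _ => r.curvature) ![w, thetaTest 4 w] - latticeSchwinger r.ρ bare (fun s => s.F) k 1 (fun _ => r.curvature) ![w] * latticeSchwinger r.ρ bare (fun s => s.F) k 1 (fun _ => r.curvature) ![thetaTest 4 w])) (SpeciesScheme.mk sch.a sch.a_pos sch.tendsto_a sch.β sch.L sch.tendsto_L (fun _ _ => 1) (fun _ _ => 0)) := by
  intro G _ _ _ _ _ _ _hG r sch u p M
  exact h G r sch u p M

/-- **The CURRENT ScalingWindowSplit triple (18927 / 18014 / 18170) closes the crux THROUGH the three stubs** — so nothing landed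
`--supports` those items is lost by the repair, and the square with the route's own typed split commutes at the level of statements. -/
theorem HypercubicLimit_ofCurrentSWS
    (hW : Summit.QuantumFields.YangMills.Theses.ScalingWindowSplit.GapAtCorrelationLength)
    (hU : Summit.QuantumFields.YangMills.Theses.ScalingWindowSplit.SelfNormalisedMomentBoundsR)
    (hS : Summit.QuantumFields.YangMills.Theses.ScalingWindowSplit.SelfNormalisedSkewnessGapped) :
    Summit.QuantumFields.YangMills.Theses.CoincidenceRotationBootstrap.HypercubicLimit :=
  HypercubicLimit_of (gapLocal_of_currentW₁ hW) (momentBoundsRS_of_currentU hU) hS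

/-- The same through the route's own landed typed split (`existenceLegFromLatticeGapped_proof`, stmt-18171). -/
theorem HypercubicLimit_ofCurrentSWS'
    (hW : Summit.QuantumFields.YangMills.Theses.ScalingWindowSplit.GapAtCorrelationLength)
    (hU : Summit.QuantumFields.YangMills.Theses.ScalingWindowSplit.SelfNormalisedMomentBoundsR)
    (hS : Summit.QuantumFields.YangMills.Theses.ScalingWindowSplit.SelfNormalisedSkewnessGapped) :
    Summit.QuantumFields.YangMills.Theses.CoincidenceRotationBootstrap.HypercubicLimit :=
  Summit.QuantumFields.YangMills.Theorems.ScalingWindowSplit.existenceLegFromLatticeGapped_proof hW hS hU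

/-- **Reshape 5's composition, kept in hypothesis form**: the twin's ∃-form heart H16 still closes the crux (landed
`hypercubicLimit_of_rpCoreDisjoint`, p149207) — but see §4: H16 is false modulo a light-flux group and no longer a registered debt. -/
theorem HypercubicLimit_ofH16
    (hcore : ∀ (G : Type) [Group G] [TopologicalSpace G] [IsTopologicalGroup G] [CompactSpace G]
      [MeasurableSpace G] [BorelSpace G], IsCompactSimpleLieGroup G →
      ∃ (r : LatticeRep G) (sch : SpeciesScheme (YMSpecies G)),
        sch.HasWeakCouplingLimit ∧ PolyVolume sch ∧ PolyRenorm r sch ∧ UniformFunctionalBoundPlanes r sch ∧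
        (∃ Δ C : ℝ, 0 < Δ ∧ RPSpectral r sch Δ C) ∧
        (∃ (f g h : 𝓢(EuclideanSpace ℝ (Fin 4), ℝ)) (δ : ℝ),
          Disjoint (tsupport f) (tsupport g) ∧ Disjoint (tsupport f) (tsupport h) ∧
          Disjoint (tsupport g) (tsupport h) ∧ 0 < δ ∧
          ∀ᶠ k in atTop, δ ≤
            |latticeSchwinger r.ρ sch (fun s => s.F) k 3 (fun _ => r.curvature) ![f, g, h] -
              latticeSchwinger r.ρ sch (fun s => s.F) k 1 (fun _ => r.curvature) ![f] *
                latticeSchwinger r.ρ sch (fun s => s.F) k 2 (fun _ => r.curvature) ![g, h] -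
              latticeSchwinger r.ρ sch (fun s => s.F) k 1 (fun _ => r.curvature) ![g] *
                latticeSchwinger r.ρ sch (fun s => s.F) k 2 (fun _ => r.curvature) ![f, h] -
              latticeSchwinger r.ρ sch (fun s => s.F) k 1 (fun _ => r.curvature) ![h] *
                latticeSchwinger r.ρ sch (fun s => s.F) k 2 (fun _ => r.curvature) ![f, g] +
              2 * (latticeSchwinger r.ρ sch (fun s => s.F) k 1 (fun _ => r.curvature) ![f] *
                latticeSchwinger r.ρ sch (fun s => s.F) k 1 (fun _ => r.curvature) ![g] *
                latticeSchwinger r.ρ sch (fun s => s.F) k 1 (fun _ => r.curvature) ![h])|)) :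
    Summit.QuantumFields.YangMills.Theses.CoincidenceRotationBootstrap.HypercubicLimit :=
  Summit.QuantumFields.YangMills.Theorems.WeakCouplingHypercubicLimit.TraceNormColdPressure.hypercubicLimit_of_rpCoreDisjoint
    hcore

/-! ## §4 Why H16 was retired: it is false modulo a light-flux group (sorry-free) -/

/-- **A light-flux mode at an admissible `G` refutes H16 at `G`.**  Bookkeeping identical to the landed
`gapAtCorrelationLength_false_of_lightFluxMode` (H16's clause `RPSpectral r sch Δ C` is the GLOBAL slab-class clustering, the very
conjunct of W₁ that the light flux violates): at a step `k` where the clause is active and `β_k` is in the light-flux regime take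
`ε := Δ a_k / 8` and the witness `(S, T, n, Y)`; the clause bounds the covariance by `e^{−εS}(e^{−Δ a_k S/8} + |C| e^{−7Δ a_k S/8}) < e^{−εS}`.
-- adapted from Theorems/GapAtCorrelationLength/Negative/GapAtCorrelationLengthFalseOfLightFluxGroup.lean [folklore] -/
theorem rpCoreDisjointAt_false_of_lightFluxMode
    (G : Type) [Group G] [TopologicalSpace G] [IsTopologicalGroup G] [CompactSpace G]
    (hH : LightFluxMode G)
    (hcoreG : letI : MeasurableSpace G := borel G
      haveI : BorelSpace G := ⟨rfl⟩
      ∃ (r : LatticeRep G) (sch : SpeciesScheme (YMSpecies G)),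
        sch.HasWeakCouplingLimit ∧ (∃ Δ C : ℝ, 0 < Δ ∧ RPSpectral r sch Δ C)) : False := by
  letI : MeasurableSpace G := borel G
  haveI : BorelSpace G := ⟨rfl⟩
  obtain ⟨r, sch, hweak, Δ, C, hΔ, hRP⟩ := hcoreG
  unfold RPSpectral at hRP
  -- a step `k` at which the RP-spectral clause is active and the coupling is in the light-flux regime
  obtain ⟨k, hRPk, hβk⟩ := (hRP.and (hweak.eventually (hH r))).exists
  have ha : 0 < sch.a k := sch.a_pos k
  have hΔa : 0 < Δ * sch.a k := mul_pos hΔ ha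
  set ε : ℝ := Δ * sch.a k / 8 with hε_def
  have hε : 0 < ε := by positivity
  set h : ℝ → ℝ := fun x =>
      Real.exp (-(Δ * sch.a k * x / 8)) + |C| * Real.exp (-(7 * (Δ * sch.a k) * x / 8)) with hh_def
  have hh : Tendsto h atTop (𝓝 0) := by
    have h1 : Tendsto (fun x : ℝ => Δ * sch.a k * x / 8) atTop atTop :=
      (tendsto_id.const_mul_atTop hΔa).atTop_div_const (by norm_num)
    have h7 : Tendsto (fun x : ℝ => 7 * (Δ * sch.a k) * x / 8) atTop atTop :=
      (tendsto_id.const_mul_atTop (by positivity : (0:ℝ) < 7 * (Δ * sch.a k))).atTop_div_const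
        (by norm_num)
    have e1 : Tendsto (fun x : ℝ => Real.exp (-(Δ * sch.a k * x / 8))) atTop (𝓝 0) :=
      Real.tendsto_exp_atBot.comp (tendsto_neg_atTop_atBot.comp h1)
    have e2 : Tendsto (fun x : ℝ => |C| * Real.exp (-(7 * (Δ * sch.a k) * x / 8))) atTop
        (𝓝 (|C| * 0)) :=
      (Real.tendsto_exp_atBot.comp (tendsto_neg_atTop_atBot.comp h7)).const_mul |C|
    simpa [hh_def] using e1.add e2
  have hhN : Tendsto (fun S : ℕ => h S) atTop (𝓝 0) := hh.comp tendsto_natCast_atTop_atTop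
  obtain ⟨N₀, hN₀⟩ := eventually_atTop.1 (hhN.eventually (gt_mem_nhds (by norm_num : (0:ℝ) < 1)))
  obtain ⟨S, T, n, hMS, h2, h4, Y, hYm, hYb, hYdep, hcov⟩ := hβk ε hε (max N₀ (sch.L k))
  have hLS : sch.L k ≤ S := (le_max_right _ _).trans hMS
  have hNS : N₀ ≤ S := (le_max_left _ _).trans hMS
  have key := hRPk S T n hLS h2 Y 1 hYm hYb hYdep
  haveI : IsProbabilityMeasure (wilsonMeasure (d := 4) (L := 2 * S + 1) (G := G) r.ρ (sch.β k)) :=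
    isProbabilityMeasure_wilsonMeasure r.ρ r.continuous _
  have hI0 : (∫ U, Y (torusLift (2 * S + 1) (GaugeConfig.timeReflect U)) * Y (torusLift (2 * S + 1) U)
      ∂(wilsonMeasure r.ρ (sch.β k) : Measure (GaugeConfig 4 (2 * S + 1) G))) ≤ 1 := by
    have hb : ∀ U : GaugeConfig 4 (2 * S + 1) G,
        ‖Y (torusLift (2 * S + 1) (GaugeConfig.timeReflect U)) * Y (torusLift (2 * S + 1) U)‖ ≤ 1 := by
      intro U
      rw [Real.norm_eq_abs, abs_mul]
      have h1 := hYb (torusLift (2 * S + 1) (GaugeConfig.timeReflect U))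
      have h2 := hYb (torusLift (2 * S + 1) U)
      have h3 := abs_nonneg (Y (torusLift (2 * S + 1) (GaugeConfig.timeReflect U)))
      nlinarith
    have hint := norm_integral_le_of_norm_le_const
      (μ := (wilsonMeasure r.ρ (sch.β k) : Measure (GaugeConfig 4 (2 * S + 1) G)))
      (Eventually.of_forall hb)
    simp only [probReal_univ, mul_one, Real.norm_eq_abs] at hint
    exact (le_abs_self _).trans hint
  generalize hIn_def : (∫ U, Y (torusLift (2 * S + 1) (GaugeConfig.timeReflect U)) *
      Y (configShift (-Pi.single 0 (n : ℤ)) (torusLift (2 * S + 1) U))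
      ∂(wilsonMeasure r.ρ (sch.β k) : Measure (GaugeConfig 4 (2 * S + 1) G))) = In at key hcov
  generalize hI0_def : (∫ U, Y (torusLift (2 * S + 1) (GaugeConfig.timeReflect U)) *
      Y (torusLift (2 * S + 1) U)
      ∂(wilsonMeasure r.ρ (sch.β k) : Measure (GaugeConfig 4 (2 * S + 1) G))) = I0 at key hI0
  generalize hm_def : (∫ U, Y (torusLift (2 * S + 1) U)
      ∂(wilsonMeasure r.ρ (sch.β k) : Measure (GaugeConfig 4 (2 * S + 1) G))) = m at key hcov
  have hS4 : (S : ℝ) ≤ 4 * n := by exact_mod_cast h4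
  have hexp_n : Real.exp (-(Δ * sch.a k * n)) ≤ Real.exp (-(Δ * sch.a k * S / 4)) := by
    apply Real.exp_le_exp.2
    nlinarith [mul_le_mul_of_nonneg_left hS4 hΔa.le]
  have hsplit4 : Real.exp (-(Δ * sch.a k * S / 4)) =
      Real.exp (-(ε * S)) * Real.exp (-(Δ * sch.a k * S / 8)) := by
    rw [← Real.exp_add, hε_def]; ring_nf
  have hsplit1 : Real.exp (-(Δ * sch.a k * S)) =
      Real.exp (-(ε * S)) * Real.exp (-(7 * (Δ * sch.a k) * S / 8)) := by
    rw [← Real.exp_add, hε_def]; ring_nf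
  have hE : 0 < Real.exp (-(ε * S)) := Real.exp_pos _
  have hexp0 : 0 ≤ Real.exp (-(Δ * sch.a k * n)) := Real.exp_nonneg _
  have hdiff : I0 - m ^ 2 ≤ 1 := by nlinarith [sq_nonneg m]
  have hup : In - m ^ 2 ≤ Real.exp (-(ε * S)) * h S := by
    have t1 : Real.exp (-(Δ * sch.a k * n)) * (I0 - m ^ 2) ≤
        Real.exp (-(ε * S)) * Real.exp (-(Δ * sch.a k * S / 8)) := by
      calc Real.exp (-(Δ * sch.a k * n)) * (I0 - m ^ 2)
          ≤ Real.exp (-(Δ * sch.a k * n)) * 1 := mul_le_mul_of_nonneg_left hdiff hexp0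
        _ ≤ Real.exp (-(Δ * sch.a k * S / 4)) := by simpa using hexp_n
        _ = _ := hsplit4
    have t2 : C * (1 : ℝ) ^ 2 * Real.exp (-(Δ * sch.a k * S)) ≤
        Real.exp (-(ε * S)) * (|C| * Real.exp (-(7 * (Δ * sch.a k) * S / 8))) := by
      rw [hsplit1]
      have hC := le_abs_self C
      have hE7 : 0 ≤ Real.exp (-(7 * (Δ * sch.a k) * S / 8)) := Real.exp_nonneg _
      nlinarith [mul_nonneg hE.le hE7]
    have hlhs : In - m ^ 2 ≤ |In - m ^ 2| := le_abs_self _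
    have : In - m ^ 2 ≤ Real.exp (-(ε * S)) * Real.exp (-(Δ * sch.a k * S / 8)) +
        Real.exp (-(ε * S)) * (|C| * Real.exp (-(7 * (Δ * sch.a k) * S / 8))) := by linarith
    simpa [hh_def, mul_add] using this
  have hhS : h S < 1 := hN₀ S hNS
  have : Real.exp (-(ε * S)) * h S < Real.exp (-(ε * S)) * 1 := mul_lt_mul_of_pos_left hhS hE
  linarith

/-- **H16 is false modulo a light-flux group** (`LightFluxGroup → ¬ H16`; intended inhabitant `G = SO(3)`, `lightFluxGroup_of_SO3`).
This is why reshape 6 retires reshape 5's sole stub: H16 quantifies its RP-spectral clause over the GLOBAL slab class for EVERY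
compact simple `G`, `SO(3)` included.  (Physics-certain, rigorously open hypothesis; H16 is not refuted in the tree.) [folklore] -/
theorem not_rpCoreDisjoint_of_lightFluxGroup (hH : LightFluxGroup) :
    ¬ (∀ (G : Type) [Group G] [TopologicalSpace G] [IsTopologicalGroup G] [CompactSpace G]
      [MeasurableSpace G] [BorelSpace G], IsCompactSimpleLieGroup G →
      ∃ (r : LatticeRep G) (sch : SpeciesScheme (YMSpecies G)),
        sch.HasWeakCouplingLimit ∧ PolyVolume sch ∧ PolyRenorm r sch ∧ UniformFunctionalBoundPlanes r sch ∧
        (∃ Δ C : ℝ, 0 < Δ ∧ RPSpectral r sch Δ C) ∧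
        (∃ (f g h : 𝓢(EuclideanSpace ℝ (Fin 4), ℝ)) (δ : ℝ),
          Disjoint (tsupport f) (tsupport g) ∧ Disjoint (tsupport f) (tsupport h) ∧
          Disjoint (tsupport g) (tsupport h) ∧ 0 < δ ∧
          ∀ᶠ k in atTop, δ ≤
            |latticeSchwinger r.ρ sch (fun s => s.F) k 3 (fun _ => r.curvature) ![f, g, h] -
              latticeSchwinger r.ρ sch (fun s => s.F) k 1 (fun _ => r.curvature) ![f] *
                latticeSchwinger r.ρ sch (fun s => s.F) k 2 (fun _ => r.curvature) ![g, h] -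
              latticeSchwinger r.ρ sch (fun s => s.F) k 1 (fun _ => r.curvature) ![g] *
                latticeSchwinger r.ρ sch (fun s => s.F) k 2 (fun _ => r.curvature) ![f, h] -
              latticeSchwinger r.ρ sch (fun s => s.F) k 1 (fun _ => r.curvature) ![h] *
                latticeSchwinger r.ρ sch (fun s => s.F) k 2 (fun _ => r.curvature) ![f, g] +
              2 * (latticeSchwinger r.ρ sch (fun s => s.F) k 1 (fun _ => r.curvature) ![f] *
                latticeSchwinger r.ρ sch (fun s => s.F) k 1 (fun _ => r.curvature) ![g] *
                latticeSchwinger r.ρ sch (fun s => s.F) k 1 (fun _ => r.curvature) ![h])|)) := by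
  obtain ⟨G, _, _, _, _, hG, hHG⟩ := hH
  intro hcore
  letI : MeasurableSpace G := borel G
  haveI : BorelSpace G := ⟨rfl⟩
  obtain ⟨r, sch, hw, -, -, -, hRP, -⟩ := hcore G hG
  exact rpCoreDisjointAt_false_of_lightFluxMode G hHG ⟨r, sch, hw, hRP⟩

end Summit.QuantumFields.YangMills.Cruxes.HypercubicLimit.PeelAndDisseminate

end
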